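import Literature.AlgebraicGeometry.VanGeemen1994.WeilDiscriminantSign
import Literature.AlgebraicGeometry.VanGeemen1994.WeilDiscriminantOfProductTop
import Literature.AlgebraicGeometry.VanGeemen1994.WeilKFrame
import Literature.AlgebraicGeometry.HodgeTheory.WeilTypeOffByOneTimesCMCurvePowersHodgeConjecture
import Literature.AlgebraicGeometry.HodgeTheory.WeilClassesSixfolds
import Literature.AlgebraicGeometry.HodgeTheory.WeilFourfoldsDiscOnePowers
import HarnessLib

/-!
# A Weil-type product of an odd-dimensional factor with a CM elliptic curve is of SPLIT Weil type

Family `hodge`, layer `Literature/AlgebraicGeometry/HodgeTheory` (seat `hodge-lit-weilregime`, LT-H2 WEIL KNOWN-REGIME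
COMPLETION, gen 5; the "prover item (i)" left by gen 4 in `WeilTypeOffByOneTimesCMCurvePowersHodgeConjecture`).
Theorems only: no definition, no named fact (D-0026). HONEST FRAMING: nothing here asserts the Hodge conjecture,
`HC_AV`, `W₆`, or anything about the GENERAL member of a Weil component; the consequences below are conditional BY
NAME on the refereed every-member facts of the split cells (Koike 2004, Schoen 1998, Markman 2023 / Floccari–Fu
2026) or on Markman's 2025 preprint, exactly as the tree's other split-cell corollaries.

## The statement and its printed source

Abdulali, JPAA **216** (2012) Thm. 14 [corpus: paper:arxiv-1203.4857 p0010:L5–L21] lists, among the members of his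
class `𝒜` with known (general) Hodge conjecture, the products `X × E` of a simple `(2,1)`-threefold / `(3,2)`-fivefold
`X` (`End⁰ = K`, `K = ℚ(i)`, `ℚ(√-3)`) with a CM elliptic curve `E`; the usual-Hodge input for `X × E` is his Math. Z.
**246** (2004) Cor. 3.3 / p. 208 (not held). The MECHANISM by which the split-cell theorems reach these products is
van Geemen's arithmetic of the discriminant (LNM 1594 (1994), Lemma 5.2 (3): `det H ∈ ℚ^*/Nm(K^*)` is an invariant of
the POLARIZED triple; 5.4 (5.4.1): signature `(n, n)` gives `det H = (-1)ⁿa`, `a > 0`, and `H` is hyperbolic iff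
`a ∈ Nm(K^*)`) together with Markman's remark that the discriminant is multiplicative under products
(arXiv:2509.23403 §11.5 Step 2; formalised in the tree as `VanGeemen1994.hasWeilDiscriminantNondeg_prod_of_kFrames`):
on `X × E` with `dim X = 2k+1` ODD, the weighted product polarizations `pr_X^*h_X + m·pr_E^*h_E` have
`det H ≡ m^{2k+1}·c ≡ m·c`, so a suitable weight `m` makes the class `[(-1)^{k+1}]` — SPLIT. This file PROVES:

* `exists_segreEmbedding_prod_curve` — the weighted Segre embeddings of `A × E` (`E` a curve): hyperplane class
  `pr_A^* h_A + s·m·pr_E^* η` for every weight `m ≥ 1` (Hartshorne II Ex. 5.11–5.12 on `H²` of complex points; the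
  tree's `Motives.exists_segreHyperplaneClasses`, as in `Motives.exists_symmetricSegreEmbedding`).
* **`isSplitWeilType_prod_cmCurve_of_isWeilType`** — for complex abelian varieties `X`, `E` with `dim X = 2k+1`
  (`k ≥ 1`), `dim E = 1`, endomorphisms `φ`, `ψ` with `φ² = -d`, `ψ² = -d`, if the product `(X × E, φ × ψ)` is of
  Weil type `(k+1, k+1)` (`IsWeilType`; i.e. `K = ℚ(√-d)` acts on `H^{1,0}(X)` with multiplicities `{k+1, k}` and
  through the complementary embedding on `H^{1,0}(E)`), then it is of SPLIT Weil type (`IsSplitWeilType`: some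
  `K`-symmetrised hyperplane class is hyperbolic). Ingredients, all PROVED in the tree: a `K`-frame of `X` with its
  Gram determinant (`VanGeemen1994.exists_kFrame_ksymm`), the model of the CM curve (`HodgeTheory.cmCurve_rationalModel`),
  the product witness and the non-vanishing of the top powers (`hasWeilDiscriminantNondeg_prod_of_kFrames`,
  `prod_kFrames_top_ne_zero`), the SIGN of the discriminant of a Weil-type pair (van Geemen (5.4.1),
  `VanGeemen1994.neg_one_pow_mul_pos_of_hasWeilDiscriminantNondeg_of_isWeilType`) to choose a POSITIVE weight, and
  Landherr's criterion on the carriers (`VanGeemen1994.isSplitWeilType_of_hasWeilDiscriminantNondeg_sq`).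
* Consequences BY NAME (no simplicity and no `End⁰(X) = K` hypothesis, unlike the vendored Abdulali fact): the Weil
  plane of every such SIXFOLD `X₅ × Ē` is algebraic — `K = ℚ(i)` (`Koike2004_weilClasses_algebraic_hyperbolicSixfold_one`,
  REFEREED), `K = ℚ(√-3)` (`Schoen1998_weilClasses_algebraic_hyperbolicSixfold_three`, REFEREED), every `K`
  (`Markman2025_weilClasses_algebraic_hyperbolicSixfold`, PREPRINT) —, and of every such FOURFOLD `X₃ × Ē` for every `K`
  (`Markman2023_weilClasses_algebraic_discOneWeilFourfold`, REFEREED), indeed every Hodge class on every power of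
  `X₃ × Ē` (`FloccariFu2026_hodgeClasses_algebraic_powers_discOneWeilFourfold`, REFEREED). These products form the
  `6`-dimensional anchor locus `{X₅ × Ē}` (resp. `{X₃ × Ē}`) of EVERY `(3, d, δ)` (resp. `(2, d, δ)`) Weil cell, the
  NON-split cells included (other weights realise the other classes of the right sign): census
  `KNOWN-REGIME-WEIL-CLASSES.md` §1 n = 3 "odd-rank product sub-loci", now for all `K` and as THEOREMS modulo the cell
  facts. The GENERAL member of a non-split cell is untouched. PRINTED TWIN (gen-6 record): Milne, arXiv:2112.12815
  Prop. 1.6 [p0004:L79–L91; preprint; same weight argument]; SUMMITS twin `Ring2.AbelianAll.isSplitWeilType_odd_prod_curve`.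

## References

* [vanGeemen1994HodgeAV] B. van Geemen, LNM 1594 (1994), Lemma 5.2 (1)–(4), 5.3, 5.4 and (5.4.1) (PDF p. 220).
* [Markman2025SurveySecant] E. Markman, arXiv:2509.23403, §11.5 Step 2 ("multiplicative under cartesian products").
* [Abdulali2012TateTwistsIV] S. Abdulali, JPAA 216 (2012) 1164–1170, Thm. 14 (the printed locus of these products).
* [Hartshorne1977] R. Hartshorne, Algebraic Geometry, II Ex. 5.11–5.12 (Segre embedding and `𝒪(1)`).
* [Koike2004WeilHodge] CMB 47 (2004) Thm. 2.1, Cor. 2.1; [Schoen1998HodgeWeilAddendum] Compositio 114 (1998);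
  [Markman2025SecantWeil] arXiv:2502.03415 Thm. 1.5.1; [Markman2023GeneralizedKummers] JEMS 25 (2023) Thm. 1.5;
  [FloccariFu2026] JMPA 210 (2026) Thm. 1.2; [Milne2021TateStandardCertainAV] arXiv:2112.12815 Prop. 1.6.
-/

noncomputable section

open CategoryTheory Polynomial Module MonoidalCategory
open scoped Matrix
open Literature.AlgebraicTopology.SingularHomology
open Literature.AlgebraicGeometry.Motives
open Literature.AlgebraicGeometry.Motives.SegreHyperplaneClass
open Literature.AlgebraicGeometry.VanGeemen1994
open Literature.Geometry.Kaehler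

namespace Literature.AlgebraicGeometry.HodgeTheory

/-! ### Weighted Segre embeddings of `A × E`, `E` a curve -/

section Segre

open _root_.AlgebraicGeometry CartesianMonoidalCategory

/-- **The weighted Segre embeddings of `A × E`** (`E` an elliptic curve, `η ≠ 0` a rational class on `H²(E(ℂ); ℂ)`):
a projective embedding `e_A` of `A` with a non-zero rational `a_A` and a rational `s` such that for every weight
`m ≥ 1` the Segre embedding of `e_A` with the `m`-fold Segre power of an embedding of `E` has hyperplane class
`pr_A^*(e_A^*a_A) + s · pr_E^*(m η)` (Segre additivity of the hyperplane classes `g_N` on `H²` of complex points,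
`Motives.exists_segreHyperplaneClasses`; `s_{m-1}^* g = m g`; `e_E^* g = s η` on the line `H²(E(ℂ); ℂ)`).
[cite: Hartshorne1977, II Ex. 5.11 and Ex. 5.12] [cite: Markman2025SurveySecant, §11.5 Step 2] -/
theorem exists_segreEmbedding_prod_curve (A E : AbelianVariety ℂ) (hE : E.dim = 1)
    (η : complexBetti E.X 2) (hη : IsRationalClass η) (hη0 : η ≠ 0) :
    ∃ (eA : ProjectiveEmbedding A.X) (aA : complexBetti (projectiveSpace eA.n ℂ) 2) (s : ℚ),
      IsRationalClass aA ∧ aA ≠ 0 ∧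
      ∀ m : ℕ, 0 < m →
        ∃ (e : ProjectiveEmbedding (A.prod E).X) (a : complexBetti (projectiveSpace e.n ℂ) 2),
          IsRationalClass a ∧ a ≠ 0 ∧
          complexBetti.map e.ι 2 a =
            complexBetti.map (AbelianVariety.fst A E).hom.hom.hom 2 (complexBetti.map eA.ι 2 aA) +
            ((s : ℚ) : ℂ) • complexBetti.map (AbelianVariety.snd A E).hom.hom.hom 2 (((m : ℕ) : ℂ) • η) := by
  obtain ⟨g, hgr, hgnz, hgσ⟩ := exists_segreHyperplaneClasses
  obtain ⟨N, e₀, hN, he₀⟩ := exists_closedImmersion_projectiveSpace_pos A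
  obtain ⟨M, f₀, hM, hf₀⟩ := exists_closedImmersion_projectiveSpace_pos E
  haveI := he₀
  haveI := hf₀
  let eA : ProjectiveEmbedding A.X := ⟨N, e₀, he₀⟩
  -- the curve: `f₀^* g = s • η`
  obtain ⟨s, hs⟩ := exists_eq_ratCast_smul_of_curve E hE hη hη0 ((hgr M).pullback (AlgPoints.mapContinuous (L := ℂ) f₀))
  refine ⟨eA, g N, s, hgr N, hgnz N hN, fun m hm ↦ ?_⟩
  obtain ⟨d₁, rfl⟩ : ∃ d, m = d + 1 := ⟨m - 1, by omega⟩
  -- the `m`-fold Segre power of `f₀`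
  obtain ⟨ιE, hιE⟩ : ∃ ι : E.X ⟶ projectiveSpace (ProjectiveSpace.segrePowDim M d₁) ℂ,
      ι = f₀ ≫ ProjectiveSpace.segrePow M ℂ d₁ := ⟨_, rfl⟩
  haveI := isClosedImmersion_segrePow_left M d₁
  haveI hιEci : IsClosedImmersion ιE.left := by
    rw [hιE]
    change IsClosedImmersion (f₀.left ≫ (ProjectiveSpace.segrePow M ℂ d₁).left)
    infer_instance
  -- the Segre embedding of `e₀ × ι_E`
  obtain ⟨ι, hι⟩ : ∃ ι : A.X ⊗ E.X ⟶ projectiveSpace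
      (N * ProjectiveSpace.segrePowDim M d₁ + N + ProjectiveSpace.segrePowDim M d₁) ℂ,
      ι = (e₀ ⊗ₘ ιE) ≫ segreEmbedding _ _ ℂ := ⟨_, rfl⟩
  haveI := isClosedImmersion_tensorHom_left (X := A.X) (Y := E.X) e₀ ιE
  have hιci : IsClosedImmersion ι.left := by
    rw [hι]
    change IsClosedImmersion ((e₀ ⊗ₘ ιE).left ≫ (segreEmbedding _ _ ℂ).left)
    infer_instance
  have hKK : 1 ≤ N * ProjectiveSpace.segrePowDim M d₁ + N + ProjectiveSpace.segrePowDim M d₁ :=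
    le_trans hN ((Nat.le_add_left _ _).trans (Nat.le_add_right _ _))
  refine ⟨⟨_, ι, hιci⟩, g _, hgr _, hgnz _ hKK, ?_⟩
  -- `ι_E^* g = m • f₀^* g = m • s • η`
  have hEcl : complexBetti.map ιE 2 (g _) = ((d₁ + 1 : ℕ) : ℂ) • complexBetti.map f₀ 2 (g M) := by
    rw [hιE, map_comp_apply', map_segrePow_of_additive g hgσ M d₁, map_smul]
  have final : complexBetti.map ι 2 (g _) =
      complexBetti.map (fst A.X E.X) 2 (complexBetti.map e₀ 2 (g N)) +
        ((s : ℚ) : ℂ) • complexBetti.map (snd A.X E.X) 2 (((d₁ + 1 : ℕ) : ℂ) • η) := by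
    rw [hι, map_comp_apply', hgσ, map_add, map_tensorHom_map_fst, map_tensorHom_map_snd, hEcl, hs]
    simp only [map_smul, smul_smul, mul_comm]
  exact final

end Segre

/-! ### The main theorem: odd `K`-rank times a CM curve is split -/

section Split

variable {X E : AbelianVariety ℂ} {φ : X ⟶ X} {ψ : E ⟶ E} {k d : ℕ}

/-- **A Weil-type product `(X × E, φ × ψ)` of an ODD-dimensional `(X, φ)` (`dim X = 2k+1`, `k ≥ 1`) with a CM
elliptic curve `(E, ψ)` (`φ² = -d`, `ψ² = -d`) is of SPLIT Weil type.** Van Geemen's arithmetic (LNM 1594, 5.2 (3),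
5.4, (5.4.1)) with Markman's multiplicativity of the discriminant (arXiv:2509.23403 §11.5 Step 2): for the
`K`-symmetrised hyperplane classes of the weighted Segre embeddings `(1, m)` of `X × E`, the discriminant class is
`[m^{2k+1} · R] = [m · R]` for a fixed `R ∈ ℚˣ` (`hasWeilDiscriminantNondeg_prod_of_kFrames` on a `K`-frame of `X`,
`exists_kFrame_ksymm`, and the model `(v, ψ^*v)` of `E`, `cmCurve_rationalModel`; tops non-zero by
`prod_kFrames_top_ne_zero`); Weil type `(k+1, k+1)` forces `(-1)^{k+1} R > 0`
(`neg_one_pow_mul_pos_of_hasWeilDiscriminantNondeg_of_isWeilType`, van Geemen (5.4.1)); so some POSITIVE integer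
weight `m` with `m · (-1)^{k+1} R` a rational square exists (`Motives.exists_nat_mul_eq_sq_mul`), the class becomes
`[(-1)^{k+1}]`, and Landherr's criterion on the carriers (`isSplitWeilType_of_hasWeilDiscriminantNondeg_sq`) gives a
hyperbolic `K`-symmetrised hyperplane class. The mechanism behind Abdulali's product members `X_r × E` of JPAA 216
Thm. 14, here for every `K` and without simplicity or `End⁰` hypotheses.
Printed as Milne, arXiv:2112.12815 Prop. 1.6 (preprint). [cite: Milne2021TateStandardCertainAV, Prop. 1.6 (preprint)]
[cite: vanGeemen1994HodgeAV, Lemma 5.2 (3), 5.4 and (5.4.1)] [cite: Markman2025SurveySecant, §11.5 Step 2]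
[cite: Abdulali2012TateTwistsIV, Thm. 14 (proof)] -/
theorem isSplitWeilType_prod_cmCurve_of_isWeilType (hk : 1 ≤ k) (hX : X.dim = 2 * k + 1) (hE : E.dim = 1)
    (hφ : φ ≫ φ = -(d • 𝟙 X)) (hψ : ψ ≫ ψ = -(d • 𝟙 E))
    (hW : IsWeilType (X.prod E)
      (AbelianVariety.prodLift (AbelianVariety.fst X E ≫ φ) (AbelianVariety.snd X E ≫ ψ)) (k + 1) d) :
    IsSplitWeilType (X.prod E)
      (AbelianVariety.prodLift (AbelianVariety.fst X E ≫ φ) (AbelianVariety.snd X E ≫ ψ)) (k + 1) d := by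
  classical
  have hd : 0 < d := hW.d_pos
  have hdQ : (0 : ℚ) < d := by exact_mod_cast hd
  have hE' : E.dim = 0 + 1 := hE
  have hm2k : 1 ≤ 2 * k := by omega
  -- (1) the model `(v, ψ^* v)` of the CM curve and its `K`-frame `x_E = (v)` of size `1`
  obtain ⟨u, η₀, hur, hui, -, hMu, -, hη₀r, hη₀0, hgramE, -, -, -⟩ := cmCurve_rationalModel hE hd hψ
  change complexBetti E.X 2 at η₀
  have hψu0 : complexBetti.map ψ.hom.hom.hom 1 (u 0) = u 1 := by
    rw [hMu 0, Fin.sum_univ_two]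
    simp
  set xB : Fin 1 → complexBetti E.X 1 := fun _ => u 0 with hxB
  have hxBr : ∀ i, IsRationalClass (xB i) := fun _ => hur 0
  have hiB : LinearIndependent ℂ (Sum.elim xB (fun i => complexBetti.map ψ.hom.hom.hom 1 (xB i))) := by
    have heq : Sum.elim xB (fun i => complexBetti.map ψ.hom.hom.hom 1 (xB i)) =
        u ∘ (finSumFinEquiv : Fin 1 ⊕ Fin 1 ≃ Fin (1 + 1)) := by
      funext t
      rcases t with i | i
      · obtain rfl : i = 0 := Subsingleton.elim _ _
        rfl
      · obtain rfl : i = 0 := Subsingleton.elim _ _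
        simp only [Sum.elim_inr, hxB, hψu0, Function.comp_apply, finSumFinEquiv_apply_right]
        rfl
    rw [heq]
    exact hui.comp _ (finSumFinEquiv : Fin 1 ⊕ Fin 1 ≃ Fin (1 + 1)).injective
  set aB : Matrix (Fin 1) (Fin 1) ℚ := Matrix.of fun _ _ => (1 : ℚ) with haB
  set bB : Matrix (Fin 1) (Fin 1) ℚ := 0 with hbB
  have hpB : ∀ (h : complexBetti E.X 2) (i j : Fin 1),
      polarizationPairingOne E.X h 0 (xB i) (complexBetti.map ψ.hom.hom.hom 1 (xB j)) = ((aB i j : ℚ) : ℂ) • η₀ ∧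
      polarizationPairingOne E.X h 0 (xB i) (xB j) = ((bB i j : ℚ) : ℂ) • η₀ := fun h i j => by
    refine ⟨?_, ?_⟩
    · simp only [hxB]
      rw [hψu0, hgramE h 0 1, haB, Matrix.of_apply]
      simp
    · simp only [hxB]
      rw [hgramE h 0 0, hbB, Matrix.zero_apply]
      simp
  have hdetB : (weilGramMatrix d aB bB).det = algebraMap ℚ (weilField d) ((1 : ℚˣ) : ℚ) := by
    rw [Matrix.det_fin_one, weilGramMatrix_apply, haB, hbB, Matrix.of_apply, Matrix.zero_apply, Units.val_one,
      map_one, map_zero, zero_mul, add_zero]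
  -- (2) the weighted Segre embeddings of `X × E` and the `K`-frame of `X` for `h_K(e_A, a_A)`
  obtain ⟨eA, aA, s, haA, haA0, hemb⟩ := exists_segreEmbedding_prod_curve X E hE η₀ hη₀r hη₀0
  set hKX : complexBetti X.X 2 :=
    (d : ℂ) • complexBetti.map eA.ι 2 aA + complexBetti.map φ.hom.hom.hom 2 (complexBetti.map eA.ι 2 aA) with hKXdef
  obtain ⟨xX, ωX, am, bm, qX, tX, hxXr, hxXi, hωXr, hωX0, hpX, hdetX, htopX⟩ :=
    exists_kFrame_ksymm hm2k hX hd hφ eA haA haA0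
  -- (3) the discriminant witness at weight `m`: class `[m^{2k+1} R]`
  set R : ℚ := ((((2 * k + 1 : ℕ) : ℚ) * (2 * (d : ℚ) * s)) ^ (2 * k + 1) * tX * (qX : ℚ)) with hRdef
  have hweight : ∀ m : ℕ, 0 < m →
      ∃ (e : ProjectiveEmbedding (X.prod E).X) (a : complexBetti (projectiveSpace e.n ℂ) 2) (U : ℚˣ),
        IsRationalClass a ∧ a ≠ 0 ∧
        HasWeilDiscriminantNondeg (X.prod E)
          (AbelianVariety.prodLift (AbelianVariety.fst X E ≫ φ) (AbelianVariety.snd X E ≫ ψ)) (k + 1) d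
          ((d : ℂ) • complexBetti.map e.ι 2 a +
            complexBetti.map (AbelianVariety.prodLift (AbelianVariety.fst X E ≫ φ)
              (AbelianVariety.snd X E ≫ ψ)).hom.hom.hom 2 (complexBetti.map e.ι 2 a))
          (QuotientGroup.mk U) ∧
        (U : ℚ) = ((m : ℕ) : ℚ) ^ (2 * k + 1) * R := by
    intro m hm
    obtain ⟨e, a, ha, ha0, he⟩ := hemb m hm
    set dB : ℚ := 2 * (d : ℚ) * s * ((m : ℕ) : ℚ) with hdBdef
    set hB2 : complexBetti E.X 2 := ((dB : ℚ) : ℂ) • η₀ with hB2def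
    -- the `K`-symmetrised class of `e` is `pr_X^* h_{K,X} + pr_E^* h_B2`
    have h1 : ∀ y : complexBetti X.X 2,
        complexBetti.map (AbelianVariety.prodLift (AbelianVariety.fst X E ≫ φ)
            (AbelianVariety.snd X E ≫ ψ)).hom.hom.hom 2 (complexBetti.map (AbelianVariety.fst X E).hom.hom.hom 2 y) =
          complexBetti.map (AbelianVariety.fst X E).hom.hom.hom 2 (complexBetti.map φ.hom.hom.hom 2 y) :=
      fun y => map_prodLift_map_fst φ ψ 2 y
    have h2 : ∀ z : complexBetti E.X 2,
        complexBetti.map (AbelianVariety.prodLift (AbelianVariety.fst X E ≫ φ)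
            (AbelianVariety.snd X E ≫ ψ)).hom.hom.hom 2 (complexBetti.map (AbelianVariety.snd X E).hom.hom.hom 2 z) =
          complexBetti.map (AbelianVariety.snd X E).hom.hom.hom 2 (complexBetti.map ψ.hom.hom.hom 2 z) :=
      fun z => map_prodLift_map_snd φ ψ 2 z
    have h3 : complexBetti.map ψ.hom.hom.hom 2 η₀ = (d : ℂ) • η₀ := cmCurve_map_two hE hd hψ η₀
    have hclass : (d : ℂ) • complexBetti.map e.ι 2 a +
        complexBetti.map (AbelianVariety.prodLift (AbelianVariety.fst X E ≫ φ)
          (AbelianVariety.snd X E ≫ ψ)).hom.hom.hom 2 (complexBetti.map e.ι 2 a) =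
        complexBetti.map (AbelianVariety.fst X E).hom.hom.hom 2 hKX +
          complexBetti.map (AbelianVariety.snd X E).hom.hom.hom 2 hB2 := by
      rw [he, hKXdef, hB2def, hdBdef]
      simp only [map_add, map_smul, h1, h2, h3, smul_add, smul_smul]
      push_cast
      module
    have hdB : lefschetzPow hB2 0 2 hB2 = ((dB : ℚ) : ℂ) • η₀ := af_top_curve η₀ dB
    -- the top powers do not vanish
    obtain ⟨htX0, hdB0⟩ := prod_kFrames_top_ne_zero (N := k + 1) hX hE' (by omega) (by omega) (by omega) one_pos hd
      hφ hψ xX hxXr hxXi hKX ωX am bm hpX tX htopX xB hxBr hiB hB2 η₀ aB bB (hpB hB2) dB hdB e ha ha0 hclass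
    -- the product witness
    have W := hasWeilDiscriminantNondeg_prod_of_kFrames (N := k + 1) hX hE' (by omega)
      ((finSumFinEquiv : Fin (2 * k + 1) ⊕ Fin 1 ≃ Fin (2 * k + 1 + 1)).trans (finCongr (by ring)))
      xX hxXr hxXi hKX ωX hωXr hωX0 am bm hpX tX htopX htX0 qX hdetX
      xB hxBr hiB hB2 η₀ hη₀r hη₀0 aB bB (hpB hB2) dB hdB hdB0 1 hdetB
    have hc1 : (2 * (k + 1) - 1).choose (2 * k) = 2 * k + 1 := by
      rw [show 2 * (k + 1) - 1 = 2 * k + 1 by omega]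
      exact Nat.choose_succ_self_right (2 * k)
    have hc2 : (2 * (k + 1) - 1).choose (2 * k + 1) = 1 := by
      rw [show 2 * (k + 1) - 1 = 2 * k + 1 by omega, Nat.choose_self]
    refine ⟨e, a, ?_⟩
    rw [hclass]
    refine ⟨_, ha, ha0, W, ?_⟩
    rw [Units.val_mul, Units.val_mul, Units.val_mk0, Units.val_one, hc1, hc2, hRdef, hdBdef,
      show ((2 * k + 1 : ℕ) : ℚ) * (2 * (d : ℚ) * s * ((m : ℕ) : ℚ)) =
        (((2 * k + 1 : ℕ) : ℚ) * (2 * (d : ℚ) * s)) * ((m : ℕ) : ℚ) from by ring, mul_pow]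
    simp only [Nat.cast_one, one_mul, pow_one, mul_one]
    ring
  -- (4) the sign at weight `1`: `(-1)^{k+1} R > 0`
  obtain ⟨e₁, a₁, U₁, ha₁, ha₁0, hW₁, hU₁⟩ := hweight 1 one_pos
  have hsign := neg_one_pow_mul_pos_of_hasWeilDiscriminantNondeg_of_isWeilType hW e₁ ha₁ ha₁0 hW₁
  rw [hU₁, Nat.cast_one, one_pow, one_mul] at hsign
  -- (5) a positive weight making the class a square times `(-1)^{k+1}`
  obtain ⟨m, hm, t, hmt⟩ := exists_nat_mul_eq_sq_mul one_pos hsign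
  obtain ⟨e, a, U, ha, ha0, hWm, hU⟩ := hweight m hm
  have hmQ : (0 : ℚ) < m := by exact_mod_cast hm
  have ht0 : t ≠ 0 := by
    rintro rfl
    have h : ((m : ℕ) : ℚ) * ((-1 : ℚ) ^ (k + 1) * R) = 0 := by rw [hmt]; ring
    rcases mul_eq_zero.1 h with h1 | h1
    · exact hmQ.ne' h1
    · exact hsign.ne' h1
  have ht'0 : ((m : ℕ) : ℚ) ^ k * t ≠ 0 := mul_ne_zero (pow_ne_zero _ hmQ.ne') ht0
  have h1 : ((-1 : ℚ) ^ (k + 1)) ^ 2 = 1 := by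
    rw [← pow_mul]
    exact Even.neg_one_pow ⟨k + 1, by ring⟩
  have hUeq : U = (-1 : ℚˣ) ^ (k + 1) * Units.mk0 ((((m : ℕ) : ℚ) ^ k * t) ^ 2) (pow_ne_zero 2 ht'0) := by
    ext
    rw [hU, Units.val_mul, Units.val_pow_eq_pow_val, Units.val_neg, Units.val_one, Units.val_mk0]
    linear_combination ((-1 : ℚ) ^ (k + 1) * ((m : ℕ) : ℚ) ^ (2 * k)) * hmt - (((m : ℕ) : ℚ) ^ (2 * k + 1) * R) * h1
  rw [hUeq] at hWm
  exact isSplitWeilType_of_hasWeilDiscriminantNondeg_sq hW e ha ha0 ht'0 hWm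

end Split

/-! ### Consequences by name: the Weil plane of `X × E` is algebraic -/

section Consequences

variable {X E : AbelianVariety ℂ} {φ : X ⟶ X} {ψ : E ⟶ E} {d : ℕ}

/-- **`K = ℚ(i)`, sixfolds `X₅ × Ē` (Koike 2004, REFEREED, every member of the split cell):** for `dim X = 5`,
`dim E = 1`, `φ² = -1`, `ψ² = -1` and `(X × E, φ × ψ)` of Weil type `(3, 3)`, the Weil plane `W_{ℚ(i)}(X × E) ⊗ ℂ`
consists of algebraic classes. The product is split (`isSplitWeilType_prod_cmCurve_of_isWeilType`) and gen 4's
mechanism lemma `weilClassesOf_prod_cmCurve_le_algebraicClasses_of_isHyperbolicWeilType_of_koike2004` applies.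
[cite: Koike2004WeilHodge, Thm. 2.1 and Cor. 2.1] [cite: vanGeemen1994HodgeAV, Lemma 5.2 (3) and 5.4 (5.4.1)] -/
theorem weilClassesOf_prod_cmCurve_le_algebraicClasses_of_koike2004
    (hK : Koike2004_weilClasses_algebraic_hyperbolicSixfold_one) (hX : X.dim = 5) (hE : E.dim = 1)
    (hφ : φ ≫ φ = -((1 : ℕ) • 𝟙 X)) (hψ : ψ ≫ ψ = -((1 : ℕ) • 𝟙 E))
    (hW : IsWeilType (X.prod E)
      (AbelianVariety.prodLift (AbelianVariety.fst X E ≫ φ) (AbelianVariety.snd X E ≫ ψ)) 3 1) :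
    weilClassesOf (X.prod E)
        (AbelianVariety.prodLift (AbelianVariety.fst X E ≫ φ) (AbelianVariety.snd X E ≫ ψ)) 3 1 ≤
      algebraicClasses (X.prod E).X 3 := by
  obtain ⟨-, e, a, ha, ha0, hhyp⟩ :=
    isSplitWeilType_prod_cmCurve_of_isWeilType (k := 2) (by norm_num) (by rw [hX]) hE hφ hψ hW
  exact weilClassesOf_prod_cmCurve_le_algebraicClasses_of_isHyperbolicWeilType_of_koike2004 hK (by rw [hX, hE])
    hφ hψ e ha ha0 hhyp

/-- **`K = ℚ(√-3)`, sixfolds `X₅ × Ē` (Schoen 1998, REFEREED, every member of the split cell):** the same with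
`φ² = -3`, `ψ² = -3`, via `weilClassesOf_prod_cmCurve_le_algebraicClasses_of_isHyperbolicWeilType_of_schoen1998`.
[cite: Schoen1998HodgeWeilAddendum, §§11–13 and Theorem p. 329] [cite: vanGeemen1994HodgeAV, Lemma 5.2 (3) and 5.4 (5.4.1)] -/
theorem weilClassesOf_prod_cmCurve_le_algebraicClasses_of_schoen1998
    (hS : Schoen1998_weilClasses_algebraic_hyperbolicSixfold_three) (hX : X.dim = 5) (hE : E.dim = 1)
    (hφ : φ ≫ φ = -((3 : ℕ) • 𝟙 X)) (hψ : ψ ≫ ψ = -((3 : ℕ) • 𝟙 E))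
    (hW : IsWeilType (X.prod E)
      (AbelianVariety.prodLift (AbelianVariety.fst X E ≫ φ) (AbelianVariety.snd X E ≫ ψ)) 3 3) :
    weilClassesOf (X.prod E)
        (AbelianVariety.prodLift (AbelianVariety.fst X E ≫ φ) (AbelianVariety.snd X E ≫ ψ)) 3 3 ≤
      algebraicClasses (X.prod E).X 3 := by
  obtain ⟨-, e, a, ha, ha0, hhyp⟩ :=
    isSplitWeilType_prod_cmCurve_of_isWeilType (k := 2) (by norm_num) (by rw [hX]) hE hφ hψ hW
  exact weilClassesOf_prod_cmCurve_le_algebraicClasses_of_isHyperbolicWeilType_of_schoen1998 hS (by rw [hX, hE])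
    hφ hψ e ha ha0 hhyp

/-- **Every `K`, sixfolds `X₅ × Ē` (Markman 2025, arXiv:2502.03415 Thm. 1.5.1, PREPRINT):** for `dim X = 5`,
`dim E = 1`, `φ² = -d`, `ψ² = -d` (`d ≥ 1`) and `(X × E, φ × ψ)` of Weil type `(3, 3)`, the Weil plane of `X × E`
consists of algebraic classes, modulo `Markman2025_weilClasses_algebraic_hyperbolicSixfold`.
[cite: Markman2025SecantWeil, Thm. 1.5.1] [cite: vanGeemen1994HodgeAV, Lemma 5.2 (3) and 5.4 (5.4.1)] -/
theorem weilClassesOf_prod_cmCurve_le_algebraicClasses_of_markman2025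
    (hM : Markman2025_weilClasses_algebraic_hyperbolicSixfold) (hX : X.dim = 5) (hE : E.dim = 1)
    (hφ : φ ≫ φ = -(d • 𝟙 X)) (hψ : ψ ≫ ψ = -(d • 𝟙 E))
    (hW : IsWeilType (X.prod E)
      (AbelianVariety.prodLift (AbelianVariety.fst X E ≫ φ) (AbelianVariety.snd X E ≫ ψ)) 3 d) :
    weilClassesOf (X.prod E)
        (AbelianVariety.prodLift (AbelianVariety.fst X E ≫ φ) (AbelianVariety.snd X E ≫ ψ)) 3 d ≤
      algebraicClasses (X.prod E).X 3 := by
  obtain ⟨-, e, a, ha, ha0, hhyp⟩ :=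
    isSplitWeilType_prod_cmCurve_of_isWeilType (k := 2) (by norm_num) (by rw [hX]) hE hφ hψ hW
  exact hW.weilClassesOf_le_algebraicClasses fun c hcW hc hH ↦
    hM d hW.d_pos (X.prod E) _ hW.dim_eq hW.isSmoothProjective hW.sq_eq e a ha ha0 hhyp c hc hH hcW

/-- **Every `K`, fourfolds `X₃ × Ē` (Markman 2023, JEMS 25 Thm. 1.5, REFEREED — discriminant `1`):** for
`dim X = 3`, `dim E = 1`, `φ² = -d`, `ψ² = -d` and `(X × E, φ × ψ)` of Weil type `(2, 2)` (Moonen–Zarhin's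
non-simple Weil fourfolds `E_k × X₃`), the Weil plane of `X × E` consists of algebraic classes, modulo
`Markman2023_weilClasses_algebraic_discOneWeilFourfold`: such a product always carries a polarization of discriminant
`1`. [cite: Markman2023GeneralizedKummers, Theorem 1.5 (= Theorem 13.4), p. 236] [cite: vanGeemen1994HodgeAV, Lemma 5.2 (3) and 5.4 (5.4.1)] -/
theorem weilClassesOf_prod_cmCurve_fourfold_le_algebraicClasses_of_markman2023
    (hM : Markman2023_weilClasses_algebraic_discOneWeilFourfold) (hX : X.dim = 3) (hE : E.dim = 1)
    (hφ : φ ≫ φ = -(d • 𝟙 X)) (hψ : ψ ≫ ψ = -(d • 𝟙 E))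
    (hW : IsWeilType (X.prod E)
      (AbelianVariety.prodLift (AbelianVariety.fst X E ≫ φ) (AbelianVariety.snd X E ≫ ψ)) 2 d) :
    weilClassesOf (X.prod E)
        (AbelianVariety.prodLift (AbelianVariety.fst X E ≫ φ) (AbelianVariety.snd X E ≫ ψ)) 2 d ≤
      algebraicClasses (X.prod E).X 2 := by
  obtain ⟨-, e, a, ha, ha0, hhyp⟩ :=
    isSplitWeilType_prod_cmCurve_of_isWeilType (k := 1) le_rfl (by rw [hX]) hE hφ hψ hW
  exact hW.weilClassesOf_le_algebraicClasses fun c hcW hc hH ↦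
    hM d hW.d_pos (X.prod E) _ hW.dim_eq hW.isSmoothProjective hW.sq_eq e a ha ha0 hhyp c hc hH hcW

/-- **Every `K`, ALL POWERS of the fourfold `X₃ × Ē` (Floccari–Fu 2026, JMPA 210 Thm. 1.2, REFEREED):** under the
same hypotheses, every rational `(p,p)` class on every power `(X × E)^{N+1}` is algebraic — the cycle part of the
summit layer's predicate, modulo `FloccariFu2026_hodgeClasses_algebraic_powers_discOneWeilFourfold`. For `K = ℚ(i)`,
`ℚ(√-3)` and `X` simple with `End⁰ = K` this is the `k = 1` row of Abdulali's Thm. 14 (JPAA 216); here every `K`, no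
simplicity. [cite: FloccariFu2026, Theorem 1.2] [cite: Abdulali2012TateTwistsIV, Thm. 14]
[cite: vanGeemen1994HodgeAV, Lemma 5.2 (3) and 5.4 (5.4.1)] -/
theorem hodgeClasses_powSucc_prod_cmCurve_fourfold_algebraic_of_floccariFu
    (hF : FloccariFu2026_hodgeClasses_algebraic_powers_discOneWeilFourfold) (hX : X.dim = 3) (hE : E.dim = 1)
    (hφ : φ ≫ φ = -(d • 𝟙 X)) (hψ : ψ ≫ ψ = -(d • 𝟙 E))
    (hW : IsWeilType (X.prod E)
      (AbelianVariety.prodLift (AbelianVariety.fst X E ≫ φ) (AbelianVariety.snd X E ≫ ψ)) 2 d) :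
    ∀ (N p : ℕ) (c : complexBetti ((X.prod E).powSucc N).X (2 * p)), IsRationalClass c →
      IsOfHodgeType ((X.prod E).powSucc N).dim ((X.prod E).powSucc N).X (2 * p) p p c →
        c ∈ algebraicClasses ((X.prod E).powSucc N).X p := by
  obtain ⟨-, e, a, ha, ha0, hhyp⟩ :=
    isSplitWeilType_prod_cmCurve_of_isWeilType (k := 1) le_rfl (by rw [hX]) hE hφ hψ hW
  exact hF d hW.d_pos (X.prod E) _ hW.dim_eq hW.sq_eq e a ha ha0 hhyp

end Consequences

end Literature.AlgebraicGeometry.HodgeTheory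

end
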